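import Mathlib.Algebra.Polynomial.Div
import Mathlib.Algebra.Polynomial.AlgebraMap
import Mathlib.Algebra.Algebra.Rat
import Mathlib.Data.Real.Basic
import Mathlib.Tactic.FieldSimp
import Mathlib.Tactic.LinearCombination

/-!
# `NormalFormPrinciple` (stmt-KontsevichZagierPeriods-3869) — stub `exists_peel_pole`
# (siege attempt k5, variation: Mathlib API route)

One peeling step of the partial-fraction expansion of `p/q` (`p q : ℚ[X]`) at a rational root `ρ`
of `q`: wherever `q(t) ≠ 0` (`t : ℝ`),

  `p(t)/q(t) = c/(t − ρ)^{k+1} + p₁(t)/q₁(t)`,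

with `q₁` a nonzero proper divisor of `q`.  The proof is a direct assembly of Mathlib's
root-multiplicity / monic-division API (`Polynomial.pow_mul_divByMonic_rootMultiplicity_eq`,
`Polynomial.eval_divByMonic_pow_rootMultiplicity_ne_zero`, `Polynomial.mul_divByMonic_eq_iff_isRoot`):
with `m = k + 1` the multiplicity of `ρ`, `q = (X − ρ)^m q₀`, `q₀(ρ) ≠ 0`, take `c = p(ρ)/q₀(ρ)`,
`p₁ = (p − c q₀)/(X − ρ)` and `q₁ = (X − ρ)^{m−1} q₀`.

Pure proof file supporting the crux item; no definitions are introduced.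
Source: folklore (partial fractions over a field), cf. M. Kontsevich, D. Zagier, *Periods* (2001), §1.2.
-/

open scoped Polynomial
open Polynomial

namespace Summit.KontsevichZagierPeriods.HurwitzMicroSectors.NormalFormPrinciple.PeelPoleK5

/-- **Peeling a rational pole** (one step of partial fractions over `ℚ`). If `q ≠ 0` and
`q(ρ) = 0` for a rational `ρ`, then there are `k : ℕ`, `c : ℚ` and `p₁ q₁ : ℚ[X]` with `q₁ ≠ 0`,
`deg q₁ < deg q`, `q₁ ∣ q`, such that `p(t)/q(t) = c/(t − ρ)^{k+1} + p₁(t)/q₁(t)` for every real `t`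
with `q(t) ≠ 0`.  Here `k + 1` is the multiplicity of `ρ` in `q`, `q = (X − ρ)^{k+1} q₀`,
`c = p(ρ)/q₀(ρ)`, `p₁ = (p − c q₀)/(X − ρ)` and `q₁ = (X − ρ)^k q₀`. [folklore] -/
theorem exists_peel_pole (p q : ℚ[X]) (hq : q ≠ 0) {ρ : ℚ} (hρ : q.IsRoot ρ) :
    ∃ (k : ℕ) (c : ℚ) (p₁ q₁ : ℚ[X]), q₁ ≠ 0 ∧ q₁.natDegree < q.natDegree ∧ q₁ ∣ q ∧
      ∀ t : ℝ, (Polynomial.aeval t q : ℝ) ≠ 0 →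
        (Polynomial.aeval t p : ℝ) / Polynomial.aeval t q =
          (c:ℝ) / (t - ρ) ^ (k + 1) + (Polynomial.aeval t p₁ : ℝ) / Polynomial.aeval t q₁ := by
  -- `m` = multiplicity of `ρ`, `q = (X - ρ)^m * q₀` with `q₀(ρ) ≠ 0` (Mathlib API).
  set m : ℕ := q.rootMultiplicity ρ
  set q₀ : ℚ[X] := q /ₘ (X - C ρ) ^ m
  have hm : 0 < m := (Polynomial.rootMultiplicity_pos hq).mpr hρ
  have hfac : (X - C ρ) ^ m * q₀ = q := q.pow_mul_divByMonic_rootMultiplicity_eq ρ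
  have hq₀ρ : q₀.eval ρ ≠ 0 := Polynomial.eval_divByMonic_pow_rootMultiplicity_ne_zero ρ hq
  have hq₀ : q₀ ≠ 0 := fun h => hq₀ρ (by rw [h, eval_zero])
  -- the residue-type coefficient and the peeled numerator
  set c : ℚ := p.eval ρ / q₀.eval ρ with hc_def
  set p₁ : ℚ[X] := (p - C c * q₀) /ₘ (X - C ρ)
  have hp₁ : (X - C ρ) * p₁ = p - C c * q₀ := by
    refine Polynomial.mul_divByMonic_eq_iff_isRoot.mpr ?_
    rw [IsRoot.def, eval_sub, eval_mul, eval_C, hc_def, div_mul_cancel₀ _ hq₀ρ, sub_self]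
  -- the smaller denominator
  set q₁ : ℚ[X] := (X - C ρ) ^ (m - 1) * q₀ with hq₁_def
  have hq_eq : q = (X - C ρ) * q₁ := by
    rw [hq₁_def, ← mul_assoc, ← pow_succ', Nat.sub_add_cancel hm, hfac]
  have hXne : (X - C ρ : ℚ[X]) ≠ 0 := X_sub_C_ne_zero ρ
  have hq₁ : q₁ ≠ 0 := mul_ne_zero (pow_ne_zero _ hXne) hq₀
  refine ⟨m - 1, c, p₁, q₁, hq₁, ?_, ?_, ?_⟩
  · -- degree drops by one
    rw [hq_eq, natDegree_mul hXne hq₁, natDegree_X_sub_C]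
    omega
  · -- `q₁ ∣ q`
    rw [hq_eq]
    exact dvd_mul_left q₁ _
  · -- the identity of real functions off the zero set of `q`
    intro t ht
    have e1 : (aeval t q : ℝ) = ((t : ℝ) - ρ) * aeval t q₁ := by
      rw [hq_eq, map_mul, map_sub, aeval_X, aeval_C, eq_ratCast]
    have e2 : (aeval t q₁ : ℝ) = ((t : ℝ) - ρ) ^ (m - 1) * aeval t q₀ := by
      rw [hq₁_def, map_mul, map_pow, map_sub, aeval_X, aeval_C, eq_ratCast]
    have e3 : ((t : ℝ) - ρ) * aeval t p₁ = aeval t p - (c : ℝ) * aeval t q₀ := by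
      have h := congrArg (aeval t) hp₁
      rwa [map_mul, map_sub, map_sub, map_mul, aeval_X, aeval_C, aeval_C, eq_ratCast,
        eq_ratCast] at h
    have htρ : (t : ℝ) - ρ ≠ 0 := by
      intro h
      exact ht (by rw [e1, h, zero_mul])
    have hq₀t : (aeval t q₀ : ℝ) ≠ 0 := by
      intro h
      exact ht (by rw [e1, e2, h, mul_zero, mul_zero])
    rw [Nat.sub_add_cancel hm, e1, e2]
    have hpow : ((t : ℝ) - ρ) ^ m = ((t : ℝ) - ρ) * ((t : ℝ) - ρ) ^ (m - 1) := by
      rw [← pow_succ', Nat.sub_add_cancel hm]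
    have hu : ((t : ℝ) - ρ) ^ (m - 1) ≠ 0 := pow_ne_zero _ htρ
    rw [hpow, div_add_div _ _ (mul_ne_zero htρ hu) (mul_ne_zero hu hq₀t),
      div_eq_div_iff (mul_ne_zero htρ (mul_ne_zero hu hq₀t))
        (mul_ne_zero (mul_ne_zero htρ hu) (mul_ne_zero hu hq₀t))]
    linear_combination (-(((t : ℝ) - ρ) * (((t : ℝ) - ρ) ^ (m - 1)) ^ 2 * aeval t q₀)) * e3

end Summit.KontsevichZagierPeriods.HurwitzMicroSectors.NormalFormPrinciple.PeelPoleK5
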